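import Summits.Ventures.PercRepro.C026Class

/-!
# C-026 on hub graphs, I: hub graphs, `bot` configurations and the cut tree (p5, gen 8)

A **hub graph** for the marks `a, b, c` is a multigraph in which every edge has a mark endpoint
(`IsHubGraph`: the non-marks — the *hubs* — are pairwise non-adjacent; it contains `K_{3,k}`).
Mine-3's Theorem §17.10 (C-026 at every `p` on every hub graph, lead ruling (jc)(1)) is proved in
`C026Hub.lean`; this file holds the vocabulary (`Link`, `OpenTo`, `HasEdge`, `IsHubV`,
`IsHubGraph.edge_cases`), the structure of a `bot` configuration on a simple hub graph (every
vertex has open edges to at most one mark — `IsBot.openTo_unique`; the cluster of a mark is the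
mark with the vertices joined to it by an open edge — `IsBot.conn_mark_iff`) and the action of
the cut tree `cutSwap` of `C026Pairing.lean` on every edge type:
`ab` stays closed (`cutSwap_link_ab`), `ac` / `bc` open (`cutSwap_link_ac/bc`), and at a hub `h`
with type `T(h) ∈ {∅, a, b, c}` (the mark of its open edge, if any): the `a`-edge is open iff
`T(h) ∈ {a, c}` (`cutSwap_link_ha`), the `b`-edge iff `T(h) ∈ {c, ∅}` (`cutSwap_link_hb`), the
`c`-edge iff `T(h) ≠ c` (`cutSwap_link_hc`).
-/

namespace PercRepro

open Finset

namespace MultiGraph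

variable {V E : Type*} (G : MultiGraph V E)

/-! ### Hub graphs -/

/-- **Hub graph** for the marks `a, b, c`: every edge has a mark endpoint (the non-marks, the
*hubs*, are pairwise non-adjacent; loops and multiplicities allowed). -/
def IsHubGraph (a b c : V) : Prop :=
  ∀ e, (G.fst e = a ∨ G.fst e = b ∨ G.fst e = c) ∨ (G.snd e = a ∨ G.snd e = b ∨ G.snd e = c)

/-- The edge `e` joins `x` and `y` (either orientation). -/
def Link (e : E) (x y : V) : Prop := (G.fst e = x ∧ G.snd e = y) ∨ (G.fst e = y ∧ G.snd e = x)

/-- `x` has an open edge to `y` in `ω`. -/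
def OpenTo (ω : Config E) (x y : V) : Prop := ∃ e, ω e = true ∧ G.Link e x y

/-- `x` has some edge to `y`. -/
def HasEdge (x y : V) : Prop := ∃ e, G.Link e x y

/-- A hub: a vertex that is not a mark. -/
def IsHubV (a b c x : V) : Prop := x ≠ a ∧ x ≠ b ∧ x ≠ c

variable {G}

/-- A link is symmetric. -/
theorem Link.symm {e : E} {x y : V} (h : G.Link e x y) : G.Link e y x := by
  rcases h with ⟨h1, h2⟩ | ⟨h1, h2⟩
  · exact Or.inr ⟨h1, h2⟩
  · exact Or.inl ⟨h1, h2⟩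

/-- Having an open edge to a vertex is symmetric. -/
theorem OpenTo.symm {ω : Config E} {x y : V} (h : G.OpenTo ω x y) : G.OpenTo ω y x := by
  obtain ⟨e, he, hl⟩ := h
  exact ⟨e, he, hl.symm⟩

/-- An open edge joining `x` and `y` connects them. -/
theorem Link.conn {ω : Config E} {e : E} {x y : V} (hl : G.Link e x y) (he : ω e = true) :
    G.Conn ω x y := by
  rcases hl with ⟨h1, h2⟩ | ⟨h1, h2⟩
  · exact Conn.of_openAdj ⟨e, he, Or.inl ⟨h1, h2⟩⟩
  · exact Conn.of_openAdj ⟨e, he, Or.inr ⟨h1, h2⟩⟩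

/-- An open edge to a vertex connects to it. -/
theorem OpenTo.conn {ω : Config E} {x y : V} (h : G.OpenTo ω x y) : G.Conn ω x y := by
  obtain ⟨e, he, hl⟩ := h
  exact hl.conn he

/-- The endpoints of `e` in terms of a link. -/
theorem Link.ends {e : E} {x y : V} (hl : G.Link e x y) :
    (G.fst e = x ∧ G.snd e = y) ∨ (G.fst e = y ∧ G.snd e = x) := hl

/-- Membership of a linked edge in the edges at a vertex set. -/
theorem Link.mem_edgesAt_iff {e : E} {x y : V} (hl : G.Link e x y) (X : Set V) :
    e ∈ G.edgesAt X ↔ x ∈ X ∨ y ∈ X := by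
  rw [mem_edgesAt]
  rcases hl with ⟨h1, h2⟩ | ⟨h1, h2⟩
  · rw [h1, h2]
  · rw [h1, h2, or_comm]

/-- In a simple graph the edge joining `x` and `y` is unique. -/
theorem Link.eq_of_isSimple (hs : G.IsSimple) {e e' : E} {x y : V} (h : G.Link e x y)
    (h' : G.Link e' x y) : e = e' := by
  apply hs.2
  unfold Parallel
  rcases h with ⟨h1, h2⟩ | ⟨h1, h2⟩ <;> rcases h' with ⟨h1', h2'⟩ | ⟨h1', h2'⟩
  · exact Or.inl ⟨h1.trans h1'.symm, h2.trans h2'.symm⟩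
  · exact Or.inr ⟨h1.trans h2'.symm, h2.trans h1'.symm⟩
  · exact Or.inr ⟨h1.trans h2'.symm, h2.trans h1'.symm⟩
  · exact Or.inl ⟨h1.trans h1'.symm, h2.trans h2'.symm⟩

/-- In a simple graph, `x` has an open edge to `y` iff the edge joining them is open. -/
theorem openTo_iff_of_link (hs : G.IsSimple) {e : E} {x y : V} (hl : G.Link e x y)
    (ω : Config E) : G.OpenTo ω x y ↔ ω e = true := by
  constructor
  · rintro ⟨e', he', hl'⟩
    rwa [hl.eq_of_isSimple hs hl']
  · intro he
    exact ⟨e, he, hl⟩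

/-- Every edge of a simple hub graph with distinct marks is a mark–mark edge or a hub–mark edge. -/
theorem IsHubGraph.edge_cases {a b c : V} (hG : G.IsHubGraph a b c) (hs : G.IsSimple) (e : E) :
    G.Link e a b ∨ G.Link e a c ∨ G.Link e b c ∨
      ∃ h, IsHubV a b c h ∧ (G.Link e h a ∨ G.Link e h b ∨ G.Link e h c) := by
  have hne := hs.1 e
  by_cases hf : G.fst e = a ∨ G.fst e = b ∨ G.fst e = c
  · -- `fst e` is a mark; the other endpoint is `snd e`
    by_cases hsd : G.snd e = a ∨ G.snd e = b ∨ G.snd e = c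
    · rcases hf with hf | hf | hf <;> rcases hsd with hsd | hsd | hsd
      · exact absurd (hf.trans hsd.symm) hne
      · exact Or.inl (Or.inl ⟨hf, hsd⟩)
      · exact Or.inr (Or.inl (Or.inl ⟨hf, hsd⟩))
      · exact Or.inl (Or.inr ⟨hf, hsd⟩)
      · exact absurd (hf.trans hsd.symm) hne
      · exact Or.inr (Or.inr (Or.inl (Or.inl ⟨hf, hsd⟩)))
      · exact Or.inr (Or.inl (Or.inr ⟨hf, hsd⟩))
      · exact Or.inr (Or.inr (Or.inl (Or.inr ⟨hf, hsd⟩)))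
      · exact absurd (hf.trans hsd.symm) hne
    · push Not at hsd
      refine Or.inr (Or.inr (Or.inr ⟨G.snd e, ⟨hsd.1, hsd.2.1, hsd.2.2⟩, ?_⟩))
      rcases hf with hf | hf | hf
      · exact Or.inl (Or.inr ⟨hf, rfl⟩)
      · exact Or.inr (Or.inl (Or.inr ⟨hf, rfl⟩))
      · exact Or.inr (Or.inr (Or.inr ⟨hf, rfl⟩))
  · push Not at hf
    rcases hG e with h | h
    · exact absurd h (by push Not; exact hf)
    · refine Or.inr (Or.inr (Or.inr ⟨G.fst e, ⟨hf.1, hf.2.1, hf.2.2⟩, ?_⟩))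
      rcases h with h | h | h
      · exact Or.inl (Or.inl ⟨rfl, h⟩)
      · exact Or.inr (Or.inl (Or.inl ⟨rfl, h⟩))
      · exact Or.inr (Or.inr (Or.inl ⟨rfl, h⟩))

/-! ### `bot` configurations on a simple hub graph -/

section Bot

variable {a b c : V} {ω : Config E}

/-- In `bot`, an open edge never joins two distinct marks. -/
theorem IsBot.not_openTo_marks (hbot : G.IsBot ω a b c) {m m' : V}
    (hm : m = a ∨ m = b ∨ m = c) (hm' : m' = a ∨ m' = b ∨ m' = c) (hne : m ≠ m') :
    ¬ G.OpenTo ω m m' := by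
  intro h
  have hc := h.conn
  obtain ⟨h1, h2, h3⟩ := hbot
  rcases hm with rfl | rfl | rfl <;> rcases hm' with rfl | rfl | rfl
  · exact hne rfl
  · exact h1 hc
  · exact h2 hc
  · exact h1 hc.symm
  · exact hne rfl
  · exact h3 hc
  · exact h2 hc.symm
  · exact h3 hc.symm
  · exact hne rfl

/-- In `bot`, a vertex has open edges to at most one mark. -/
theorem IsBot.openTo_unique (hbot : G.IsBot ω a b c) {x m m' : V}
    (hm : m = a ∨ m = b ∨ m = c) (hm' : m' = a ∨ m' = b ∨ m' = c) (hne : m ≠ m')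
    (h : G.OpenTo ω x m) (h' : G.OpenTo ω x m') : False := by
  have hc : G.Conn ω m m' := h.conn.symm.trans h'.conn
  obtain ⟨h1, h2, h3⟩ := hbot
  rcases hm with rfl | rfl | rfl <;> rcases hm' with rfl | rfl | rfl
  · exact hne rfl
  · exact h1 hc
  · exact h2 hc
  · exact h1 hc.symm
  · exact hne rfl
  · exact h3 hc
  · exact h2 hc.symm
  · exact h3 hc.symm
  · exact hne rfl

/-- **The cluster of a mark in `bot`**: the mark and the vertices with an open edge to it. -/
theorem IsBot.conn_mark_iff (hG : G.IsHubGraph a b c) (hs : G.IsSimple) (hbot : G.IsBot ω a b c)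
    {m : V} (hm : m = a ∨ m = b ∨ m = c) (v : V) :
    G.Conn ω m v ↔ v = m ∨ G.OpenTo ω v m := by
  constructor
  · intro hv
    refine G.mem_of_conn_of_closed_boundary (X := {v | v = m ∨ G.OpenTo ω v m})
      (fun e he => ?_) (Or.inl rfl) hv
    simp only [Set.mem_setOf_eq]
    -- the open edge `e` has a mark endpoint `m₁`; the other endpoint `z`
    have key : ∀ m₁ z : V, (m₁ = a ∨ m₁ = b ∨ m₁ = c) → G.Link e m₁ z →
        ((m₁ = m ∨ G.OpenTo ω m₁ m) ↔ (z = m ∨ G.OpenTo ω z m)) := by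
      intro m₁ z hm₁ hl
      by_cases hz : z = a ∨ z = b ∨ z = c
      · -- a mark–mark edge: open in `bot` only if it is a loop
        have hzm : z ≠ m₁ := by
          rintro rfl
          exact hs.1 e (by rcases hl with ⟨h1, h2⟩ | ⟨h1, h2⟩ <;> rw [h1, h2])
        exact absurd ⟨e, he, hl.symm⟩ (hbot.not_openTo_marks hz hm₁ hzm)
      · by_cases h1 : m₁ = m
        · subst h1
          constructor
          · intro _
            exact Or.inr ⟨e, he, hl.symm⟩
          · intro _
            exact Or.inl rfl
        · constructor
          · rintro (h | h)
            · exact absurd h h1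
            · exact absurd h (hbot.not_openTo_marks hm₁ hm h1)
          · rintro (h | h)
            · exact absurd (h ▸ hm) hz
            · exact (hbot.openTo_unique hm₁ hm h1 ⟨e, he, hl.symm⟩ h).elim
    rcases hG e with hf | hf
    · exact key _ _ hf (Or.inl ⟨rfl, rfl⟩)
    · exact (key _ _ hf (Or.inr ⟨rfl, rfl⟩)).symm
  · rintro (rfl | h)
    · exact Conn.refl G ω v
    · exact h.conn.symm

/-- In `bot`, the cluster of a mark consists of the mark and the vertices with an open edge to it. -/
theorem IsBot.mem_cluster_iff (hG : G.IsHubGraph a b c) (hs : G.IsSimple) (hbot : G.IsBot ω a b c)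
    {m : V} (hm : m = a ∨ m = b ∨ m = c) (x : V) :
    x ∈ G.cluster ω m ↔ x = m ∨ G.OpenTo ω x m := by
  rw [mem_cluster]
  exact hbot.conn_mark_iff hG hs hm x

/-- A mark is in the cluster of another mark only if they coincide. -/
theorem IsBot.mark_mem_cluster_iff (hG : G.IsHubGraph a b c) (hs : G.IsSimple)
    (hbot : G.IsBot ω a b c) {m m' : V} (hm : m = a ∨ m = b ∨ m = c)
    (hm' : m' = a ∨ m' = b ∨ m' = c) : m' ∈ G.cluster ω m ↔ m' = m := by
  rw [hbot.mem_cluster_iff hG hs hm]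
  constructor
  · rintro (h | h)
    · exact h
    · by_contra hne
      exact hbot.not_openTo_marks hm' hm hne h
  · exact Or.inl

/-- A hub is in the cluster of a mark iff it has an open edge to it. -/
theorem IsBot.hub_mem_cluster_iff (hG : G.IsHubGraph a b c) (hs : G.IsSimple)
    (hbot : G.IsBot ω a b c) {m h : V} (hm : m = a ∨ m = b ∨ m = c) (hh : IsHubV a b c h) :
    h ∈ G.cluster ω m ↔ G.OpenTo ω h m := by
  rw [hbot.mem_cluster_iff hG hs hm]
  constructor
  · rintro (h' | h')
    · exfalso
      rcases hm with rfl | rfl | rfl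
      · exact hh.1 h'
      · exact hh.2.1 h'
      · exact hh.2.2 h'
    · exact h'
  · exact Or.inr

/-! ### The cut tree on a simple hub graph in `bot` -/

/-- An `ab`-edge is closed in `bot` and not flipped: closed in `δ(ω)`. -/
theorem IsBot.cutSwap_link_ab (hG : G.IsHubGraph a b c) (hs : G.IsSimple) (hab : a ≠ b)
    (hac : a ≠ c) (hbc : b ≠ c) (hbot : G.IsBot ω a b c) {e : E} (hl : G.Link e a b) :
    G.cutSwap a b c ω e = false := by
  have hmem : e ∉ G.swapSetC ω a b c := by
    rw [mem_swapSetC, hl.mem_edgesAt_iff, hl.mem_edgesAt_iff, hl.mem_edgesAt_iff,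
      hbot.mark_mem_cluster_iff hG hs (Or.inr (Or.inr rfl)) (Or.inl rfl),
      hbot.mark_mem_cluster_iff hG hs (Or.inr (Or.inr rfl)) (Or.inr (Or.inl rfl)),
      hbot.mark_mem_cluster_iff hG hs (Or.inl rfl) (Or.inl rfl)]
    simp [hac, hbc]
  rw [G.cutSwap_apply_of_notMem hmem]
  cases he : ω e
  · rfl
  · exact absurd ⟨e, he, hl⟩ (hbot.not_openTo_marks (Or.inl rfl) (Or.inr (Or.inl rfl)) hab)

/-- An `ac`-edge is closed in `bot` and flipped: open in `δ(ω)`. -/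
theorem IsBot.cutSwap_link_ac (hac : a ≠ c) (hbot : G.IsBot ω a b c) {e : E}
    (hl : G.Link e a c) : G.cutSwap a b c ω e = true := by
  have hmem : e ∈ G.swapSetC ω a b c := by
    rw [mem_swapSetC, hl.mem_edgesAt_iff]
    exact Or.inl (Or.inr (G.self_mem_cluster ω c))
  rw [G.cutSwap_apply_of_mem hmem]
  cases he : ω e
  · rfl
  · exact absurd ⟨e, he, hl⟩ (hbot.not_openTo_marks (Or.inl rfl) (Or.inr (Or.inr rfl)) hac)

/-- A `bc`-edge is closed in `bot` and flipped: open in `δ(ω)`. -/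
theorem IsBot.cutSwap_link_bc (hbc : b ≠ c) (hbot : G.IsBot ω a b c) {e : E}
    (hl : G.Link e b c) : G.cutSwap a b c ω e = true := by
  have hmem : e ∈ G.swapSetC ω a b c := by
    rw [mem_swapSetC, hl.mem_edgesAt_iff]
    exact Or.inl (Or.inr (G.self_mem_cluster ω c))
  rw [G.cutSwap_apply_of_mem hmem]
  cases he : ω e
  · rfl
  · exact absurd ⟨e, he, hl⟩ (hbot.not_openTo_marks (Or.inr (Or.inl rfl)) (Or.inr (Or.inr rfl)) hbc)

/-- **The `a`-edge of a hub in `δ(ω)`**: open iff the hub's open edge goes to `a` or to `c`. -/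
theorem IsBot.cutSwap_link_ha (hG : G.IsHubGraph a b c) (hs : G.IsSimple) (hab : a ≠ b)
    (hac : a ≠ c) (hbot : G.IsBot ω a b c) {e : E} {h : V} (hh : IsHubV a b c h)
    (hl : G.Link e h a) :
    G.cutSwap a b c ω e = true ↔ G.OpenTo ω h a ∨ G.OpenTo ω h c := by
  have hmem : e ∈ G.swapSetC ω a b c ↔ G.OpenTo ω h c := by
    rw [mem_swapSetC, hl.mem_edgesAt_iff, hl.mem_edgesAt_iff, hl.mem_edgesAt_iff,
      hbot.hub_mem_cluster_iff hG hs (Or.inr (Or.inr rfl)) hh,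
      hbot.hub_mem_cluster_iff hG hs (Or.inr (Or.inl rfl)) hh,
      hbot.hub_mem_cluster_iff hG hs (Or.inl rfl) hh,
      hbot.mark_mem_cluster_iff hG hs (Or.inr (Or.inr rfl)) (Or.inl rfl),
      hbot.mark_mem_cluster_iff hG hs (Or.inr (Or.inl rfl)) (Or.inl rfl),
      hbot.mark_mem_cluster_iff hG hs (Or.inl rfl) (Or.inl rfl)]
    simp [hac, hab]
  have hω : ω e = true ↔ G.OpenTo ω h a := (openTo_iff_of_link hs hl ω).symm
  have hex : ¬ (G.OpenTo ω h a ∧ G.OpenTo ω h c) := fun ⟨h1, h2⟩ =>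
    hbot.openTo_unique (Or.inl rfl) (Or.inr (Or.inr rfl)) hac h1 h2
  by_cases hc : G.OpenTo ω h c
  · rw [G.cutSwap_apply_of_mem (hmem.2 hc)]
    have h0 : ω e = false := by
      cases he : ω e
      · rfl
      · exact absurd ⟨hω.1 he, hc⟩ hex
    rw [h0]
    simp [hc]
  · rw [G.cutSwap_apply_of_notMem (fun h' => hc (hmem.1 h')), hω]
    simp [hc]

/-- **The `b`-edge of a hub in `δ(ω)`**: open iff the hub's open edge goes to `c`, or the hub has
no open edge at all. -/
theorem IsBot.cutSwap_link_hb (hG : G.IsHubGraph a b c) (hs : G.IsSimple) (hab : a ≠ b)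
    (hbc : b ≠ c) (hbot : G.IsBot ω a b c) {e : E} {h : V} (hh : IsHubV a b c h)
    (hl : G.Link e h b) :
    G.cutSwap a b c ω e = true ↔
      G.OpenTo ω h c ∨ (¬ G.OpenTo ω h a ∧ ¬ G.OpenTo ω h b ∧ ¬ G.OpenTo ω h c) := by
  have hmem : e ∈ G.swapSetC ω a b c ↔ G.OpenTo ω h c ∨ ¬ G.OpenTo ω h a := by
    rw [mem_swapSetC, hl.mem_edgesAt_iff, hl.mem_edgesAt_iff, hl.mem_edgesAt_iff,
      hbot.hub_mem_cluster_iff hG hs (Or.inr (Or.inr rfl)) hh,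
      hbot.hub_mem_cluster_iff hG hs (Or.inr (Or.inl rfl)) hh,
      hbot.hub_mem_cluster_iff hG hs (Or.inl rfl) hh,
      hbot.mark_mem_cluster_iff hG hs (Or.inr (Or.inr rfl)) (Or.inr (Or.inl rfl)),
      hbot.mark_mem_cluster_iff hG hs (Or.inr (Or.inl rfl)) (Or.inr (Or.inl rfl)),
      hbot.mark_mem_cluster_iff hG hs (Or.inl rfl) (Or.inr (Or.inl rfl))]
    simp [hbc, hab.symm]
  have hω : ω e = true ↔ G.OpenTo ω h b := (openTo_iff_of_link hs hl ω).symm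
  have hbc' : ¬ (G.OpenTo ω h b ∧ G.OpenTo ω h c) := fun ⟨h1, h2⟩ =>
    hbot.openTo_unique (Or.inr (Or.inl rfl)) (Or.inr (Or.inr rfl)) hbc h1 h2
  have hab' : ¬ (G.OpenTo ω h a ∧ G.OpenTo ω h b) := fun ⟨h1, h2⟩ =>
    hbot.openTo_unique (Or.inl rfl) (Or.inr (Or.inl rfl)) hab h1 h2
  by_cases hc : G.OpenTo ω h c
  · rw [G.cutSwap_apply_of_mem (hmem.2 (Or.inl hc))]
    have h0 : ω e = false := by
      cases he : ω e
      · rfl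
      · exact absurd ⟨hω.1 he, hc⟩ hbc'
    rw [h0]
    simp [hc]
  by_cases ha : G.OpenTo ω h a
  · rw [G.cutSwap_apply_of_notMem (fun h' => by
      rcases hmem.1 h' with h' | h'
      · exact hc h'
      · exact h' ha)]
    have h0 : ω e = false := by
      cases he : ω e
      · rfl
      · exact absurd ⟨ha, hω.1 he⟩ hab'
    rw [h0]
    simp [hc, ha]
  · rw [G.cutSwap_apply_of_mem (hmem.2 (Or.inr ha))]
    constructor
    · intro h'
      refine Or.inr ⟨ha, ?_, hc⟩
      rw [← hω]
      simpa using h'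
    · rintro (h' | ⟨-, h', -⟩)
      · exact absurd h' hc
      · rw [← hω] at h'
        simpa using h'

/-- **The `c`-edge of a hub in `δ(ω)`**: open iff the hub has no open edge to `c`. -/
theorem cutSwap_link_hc (hs : G.IsSimple) {e : E} {h : V}
    (hl : G.Link e h c) : G.cutSwap a b c ω e = true ↔ ¬ G.OpenTo ω h c := by
  have hmem : e ∈ G.swapSetC ω a b c := by
    rw [mem_swapSetC, hl.mem_edgesAt_iff]
    exact Or.inl (Or.inr (G.self_mem_cluster ω c))
  rw [G.cutSwap_apply_of_mem hmem, openTo_iff_of_link hs hl ω]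
  cases ω e <;> simp

end Bot

end MultiGraph

end PercRepro
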